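import Summits.BirchSwinnertonDyer.Rank1Residual.X5.TwoAdicAdditiveL2Converse
import Literature.NumberTheory.EllipticCurves.NonvanishingTwistsHoffsteinLuo
import Literature.NumberTheory.QuadraticFields.FundamentalDiscriminant
import HarnessLib

/-!
# X5 at `p = 2` (cell `bsd-2adic`, seat `bsd-2adic-mult`, GEN 4): the TWIST SUPPLY of the RN-2 road
# is PRINT — a quadratic field with `2` split and a non-vanishing twist, for EVERY `E/ℚ`, from
# Hoffstein–Luo 1997

The cell's proved 2-converse assembly `AddTwoL2.analyticRank_eq_of_selmerCorank_two_eq` (RN-2; the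
road of the route `TwoAdicConverse`, rung S3) consumes, besides Kato's finiteness at `2`,
Dokchitser–Dokchitser L. 4.14 and modularity, two inputs: (b_P) an auxiliary quadratic field `K`
admissible for `P` with `L(E^(d_K), 1) ≠ 0` (`AddTwoL2.ExistsNonvanishingTwistWith W P`) and the
corank-`r` converse OVER `K`. For the admissibility predicate of the ordinary / multiplicative
branches, `P = AddTwoL2Cyc.TwoSplit` («`2` splits in `K`», `d_K ≡ 1 (mod 8)`), input (b_P) is a
PRINTED THEOREM for every elliptic curve over `ℚ`, with NO root-number hypothesis: Hoffstein–Luo's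
non-vanishing theorem (tree fact `HoffsteinLuo1997_exists_twist_L_one_ne_zero`: a squarefree
`d ≡ 1 (mod 8)` of either sign, as large as wanted, with `L(E^(d), 1) ≠ 0`) and the classical
bijection «fundamental discriminants ↔ quadratic fields» (tree theorem
`Quadratic.exists_numberField_discr_eq`, here for `D = d ≡ 1 (mod 4)` squarefree, `d ≠ 1`). So the
BC3 stub `stub_twist` of the cruxes `GoodOrdinaryRankZeroTwoConverse` /
`MultiplicativeRankZeroTwoConverse` / `RankOneTwoConverse` (items stmt-BirchSwinnertonDyer-19218 /
19219 / 19220) is discharged modulo that one named PRINT fact — the load-bearing stub of each is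
the converse OVER `K` alone.

HONEST FRAMING: one theorem, conditional on the displayed Literature fact (Hoffstein–Luo 1997,
Math. Res. Lett. 4, Theorem of §1); nothing about any converse is asserted; no class is closed.
PARTITION: none — RANK axis (S3; input (b_P) of the RN-2 road for the 611 good-ordinary + 1 976
multiplicative X5@2 classes and every non-CM `E`); companion formula cells X5@2 (B1·O1), owner
bsd-2adic. [cite: HoffsteinLuo1997, Theorem (§1, pp. 435–436)]
[cite: BurungaleSkinnerTianWan2024, proof of Thm 4.3 (arXiv:2409.01350 p. 82: the choice of L by [FH])]
-/

set_option autoImplicit false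
set_option linter.dupNamespace false

noncomputable section

open scoped Classical

open WeierstrassCurve Literature.NumberTheory.EllipticCurves
  Literature.NumberTheory.QuadraticFields

namespace Summit.BirchSwinnertonDyer.BirchSwinnertonDyer.Theorems

open Summit.BirchSwinnertonDyer.Rank1Residual.X5 Summit.BirchSwinnertonDyer.Rank1Residual.X5.AddTwoL2Cyc

/-- **Twist supply with `2` split, for every `E/ℚ` (PROVED modulo Hoffstein–Luo 1997).** For every
elliptic curve `W/ℚ` there is a quadratic field `K` with `d_K ≡ 1 (mod 8)` (`TwoSplit K`: `2`
splits in `K`) and `L(W^(d_K), 1) ≠ 0` — input (b_P) of the RN-2 road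
`AddTwoL2.analyticRank_eq_of_selmerCorank_two_eq` for `P = TwoSplit`. Proof: Hoffstein–Luo give a
squarefree `d ≡ 1 (mod 8)` with `|d| > 1` and `L(W^(d), 1) ≠ 0`; such a `d` is a fundamental
discriminant `≠ 1`, hence `d = d_K` for a quadratic field `K` (`Quadratic.exists_numberField_discr_eq`).
[cite: HoffsteinLuo1997, Theorem (§1, pp. 435–436)] -/
theorem existsNonvanishingTwistWith_twoSplit_of_hoffsteinLuo
    (hHL : HoffsteinLuo1997_exists_twist_L_one_ne_zero) (W : WeierstrassCurve ℚ) [W.IsElliptic] :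
    AddTwoL2.ExistsNonvanishingTwistWith W (fun K _ _ => TwoSplit K) := by
  obtain ⟨d, hB, hsq, hd8, -, -, hL⟩ := hHL W ∅ 1
  have hd1 : d ≠ 1 := by
    rintro rfl
    simp at hB
  have hD : (d % 4 = 1 ∧ Squarefree d ∧ d ≠ 1) ∨
      (4 ∣ d ∧ (d / 4 % 4 = 2 ∨ d / 4 % 4 = 3) ∧ Squarefree (d / 4)) :=
    Or.inl ⟨by omega, hsq, hd1⟩
  obtain ⟨K, _, _, h2, hdisc⟩ := Quadratic.exists_numberField_discr_eq hD
  refine ⟨K, inferInstance, inferInstance, h2, ?_, ?_⟩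
  · show NumberField.discr K % 8 = 1
    rw [hdisc]; exact hd8
  · rw [hdisc]; exact hL

/-- The same supply restated for the abstract road: input (b_P) of
`AddTwoL2.analyticRank_eq_of_selmerCorank_two_eq` with `P = TwoSplit` holds for every `W`, so the
2-converse for `W` at any `r` follows from Kato's finiteness at `2`, Dokchitser–Dokchitser L. 4.14,
modularity and the corank-`r` converse over every admissible `K` (`AddTwoL2.TwoConverseOverAt W K r`).
Bookkeeping. [cite: HoffsteinLuo1997, Theorem (§1, pp. 435–436)]
[cite: Kato2004Asterisque, Cor 14.3] [cite: DokchitserDokchitser2010, Lemma 4.14] -/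
theorem analyticRank_eq_of_selmerCorank_two_eq_of_hoffsteinLuo
    (hHL : HoffsteinLuo1997_exists_twist_L_one_ne_zero)
    (hKato : ∀ (V : WeierstrassCurve ℚ) [V.IsElliptic], kato_finite_of_L_one_ne_zero V 2)
    (hbc : selmerCorank_baseChange_quadratic) (hE : hasEntireLFunction_rat)
    (W : WeierstrassCurve ℚ) [W.IsElliptic] (r : ℕ)
    (hX : ∀ (K : Type) [Field K] [NumberField K], Module.finrank ℚ K = 2 → TwoSplit K →
      (W.quadraticTwist (NumberField.discr K : ℚ)).entireLFunction 1 ≠ 0 →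
      AddTwoL2.TwoConverseOverAt W K r)
    (hcorank : W.selmerCorank 2 = r) : W.analyticRank = r :=
  AddTwoL2.analyticRank_eq_of_selmerCorank_two_eq W (fun K _ _ => TwoSplit K) hKato hbc hE
    (existsNonvanishingTwistWith_twoSplit_of_hoffsteinLuo hHL W) r hX hcorank

end Summit.BirchSwinnertonDyer.BirchSwinnertonDyer.Theorems

end
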